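import Mathlib
import HarnessLib

/-!
# ValiantsHypothesis / LacunarySymmetroid — crux `MatrixDescartes` (stmt-ValiantsHypothesis-18050, V1),
# line `Cruxes/MatrixDescartes/Lines/osculation_law.lean` («osculation-law»): pencil bookkeeping for the `m = 2` rung

Small Mathlib-only facts used by `…OsculationLawTwoK`: the embedding `ι : X ↦ X₀` on pencils with an arbitrary
index type, the monomial form and the exponent set of a pencil entry, the block projectors `I₀ ⊕ 0 = 0` on
`Fin 0 ⊕ Fin 2` and `I₂ ⊕ 0 = 1` on `Fin 2 ⊕ Fin 0`, the `2 × 2` determinant on `Fin 2 ⊕ Fin 0`, and a power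
comparison.  Honest framing: bookkeeping only; nothing here bears on `OsculationLaw`, `MatrixDescartes`,
Conjecture B or `VP ≠ VNP`.  No definitions, no named facts.
-/

-- `Summit.ValiantsHypothesis.ValiantsHypothesis.…` is the tree's mandated single-conjunct layout (Sub = Summit).
set_option linter.dupNamespace false

noncomputable section

namespace Summit.ValiantsHypothesis.ValiantsHypothesis.Theorems.LacunarySymmetroidMatrixDescartes

open Polynomial Matrix
open scoped BigOperators Pointwise

namespace OsculationTwoK
/-! ### Pencil bookkeeping -/

/-- The embedding `ι : X ↦ X₀` maps the one-variable pencil to the pencil in `X₀` (any index type). [folklore] -/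
theorem map_aevalX0_pencil_gen {ι : Type*} [Fintype ι] [DecidableEq ι] {K : ℕ} (d : Fin K → ℕ)
    (T : Fin K → Matrix ι ι ℝ) :
    (∑ l, (X : ℝ[X]) ^ d l • (T l).map Polynomial.C).map (Polynomial.aeval (MvPolynomial.X 0 : MvPolynomial (Fin 2) ℝ)) =
      ∑ l, (MvPolynomial.X (0 : Fin 2) : MvPolynomial (Fin 2) ℝ) ^ d l • (T l).map (MvPolynomial.C : ℝ →+* MvPolynomial (Fin 2) ℝ) := by
  refine Matrix.ext fun i j => ?_
  simp only [Matrix.map_apply, Matrix.sum_apply, Matrix.smul_apply, map_sum, smul_eq_mul, map_mul, map_pow,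
    Polynomial.aeval_X, Polynomial.aeval_C, MvPolynomial.algebraMap_eq]

/-- An entry of the pencil, as a sum of monomials. [folklore] -/
theorem pencil_apply {ι : Type*} [Fintype ι] [DecidableEq ι] {K : ℕ} (d : Fin K → ℕ)
    (T : Fin K → Matrix ι ι ℝ) (i j : ι) :
    (∑ l, (X : ℝ[X]) ^ d l • (T l).map Polynomial.C) i j = ∑ l, Polynomial.C (T l i j) * X ^ d l := by
  simp only [Matrix.sum_apply, Matrix.smul_apply, Matrix.map_apply, smul_eq_mul]
  exact Finset.sum_congr rfl fun l _ => mul_comm _ _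

/-- The exponents of an entry of the pencil lie in the image of `d`. [folklore] -/
theorem support_pencil_apply {ι : Type*} [Fintype ι] [DecidableEq ι] {K : ℕ} (d : Fin K → ℕ)
    (T : Fin K → Matrix ι ι ℝ) (i j : ι) :
    ((∑ l, (X : ℝ[X]) ^ d l • (T l).map Polynomial.C) i j).support ⊆ 1 • Finset.univ.image d := by
  rw [one_nsmul, pencil_apply]
  intro n hn
  rw [mem_support_iff, finsetSum_coeff] at hn
  obtain ⟨l, -, hl⟩ := Finset.exists_ne_zero_of_sum_ne_zero hn
  rw [coeff_C_mul_X_pow] at hl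
  split_ifs at hl with h
  · exact Finset.mem_image.2 ⟨l, Finset.mem_univ _, h.symm⟩
  · exact absurd rfl hl

/-- `I₀ ⊕ 0 = 0` on `Fin 0 ⊕ Fin 2`. [folklore] -/
theorem blockProj_zero_two : (Matrix.fromBlocks 1 0 0 0 : Matrix (Fin 0 ⊕ Fin 2) (Fin 0 ⊕ Fin 2) ℝ) = 0 := by
  ext i j
  rcases i with i | i
  · exact i.elim0
  rcases j with j | j
  · exact j.elim0
  · rfl

/-- `I₂ ⊕ 0 = 1` on `Fin 2 ⊕ Fin 0`. [folklore] -/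
theorem blockProj_two_zero : (Matrix.fromBlocks 1 0 0 0 : Matrix (Fin 2 ⊕ Fin 0) (Fin 2 ⊕ Fin 0) ℝ) = 1 := by
  rw [show (0 : Matrix (Fin 0) (Fin 0) ℝ) = 1 from Subsingleton.elim _ _, Matrix.fromBlocks_one]

/-- A `2 × 2` determinant on `Fin 2 ⊕ Fin 0`: `det N = N₀₀ N₁₁ − N₀₁ N₁₀` (indices `inl`). [folklore] -/
theorem det_two_zero {R : Type*} [CommRing R] (N : Matrix (Fin 2 ⊕ Fin 0) (Fin 2 ⊕ Fin 0) R) :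
    N.det = N (Sum.inl 0) (Sum.inl 0) * N (Sum.inl 1) (Sum.inl 1)
      - N (Sum.inl 0) (Sum.inl 1) * N (Sum.inl 1) (Sum.inl 0) := by
  rw [← Matrix.det_reindex_self (Equiv.sumEmpty (Fin 2) (Fin 0)) N, Matrix.det_fin_two]
  simp [Matrix.reindex_apply, Matrix.submatrix_apply, Equiv.sumEmpty_symm_apply]

/-- A power bookkeeping step: `K^i ≤ K^12` for `1 ≤ i ≤ 12`. [folklore] -/
theorem pow_le_pow_twelve (K i : ℕ) (h1 : 1 ≤ i) (h12 : i ≤ 12) : K ^ i ≤ K ^ 12 := by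
  rcases Nat.eq_zero_or_pos K with hK | hK
  · subst hK; rw [zero_pow (by omega), zero_pow (by omega)]
  · exact Nat.pow_le_pow_right hK h12

end OsculationTwoK

end Summit.ValiantsHypothesis.ValiantsHypothesis.Theorems.LacunarySymmetroidMatrixDescartes
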